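import Literature.Geometry.Symplectic.SphereIntersectionIndexHomologicalProofs
import HarnessLib

/-!
# Intersection indices of spheres with a closed co-oriented surface: the non-compact ambient case

Companion of `SphereIntersectionIndexHomologicalProofs.lean` (G. E. Bredon, *Topology and
Geometry* (1993), VI.11 Def. 11.1, Thm. 11.9, p. 375; IV.7 Cor. 7.5): the same homological
argument, recorded for an arbitrary (not necessarily compact) Hausdorff second countable
4-manifold `X` and a CLOSED zero set `K = {y ∈ U | π y = 0}` of a smooth `π` on an open `U`
(no submersion hypothesis). This is the form needed by the uniqueness clause of the
Hofer–Lizan–Sikorav local foliation statement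
`Literature.Geometry.Symplectic.hls_localFoliation_embeddedSphere_trivialNormal`
(`JSphereLocalFoliation.lean`, Wendl 2018 Prop. 2.53 / Thm. 2.49), whose ambient almost complex
4-manifold is not assumed compact: the leaves of the local foliation are compact, hence closed,
zero sets of the leaf coordinates of `JSphereFamilyLeafFunction.lean`.

* `sphere_zeroSetIndex_factorsThroughHomology_of_isClosed` — there is an additive
  `c : H₂(X; ℤ) → ℤ` such that for every smooth two-chart sphere `(u, v)` meeting `K` at finitely
  many parameters, with glued map `F`, `c (F_*[ℂℙ¹])` is, for all small radii, the sum of the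
  winding numbers of `π ∘ u` about the crossings plus that of `π ∘ v` about `0` if `v 0 ∈ K`.

The proof is that of `sphere_zeroSetIndex_factorsThroughHomology_holds` verbatim (it used the
compactness of `K` only through `IsCompact.isClosed`, and neither the compactness of `X` nor
the submersion hypothesis at all); everything is proved, no definitions, no named facts.

## References

* G. E. Bredon, *Topology and Geometry*, GTM 139, Springer (1993), VI.11 (Def. 11.1, Thm. 11.9,
  p. 375) and IV.7 (Cor. 7.5 and Example). [Bredon1993]
* C. Wendl, *Holomorphic Curves in Low Dimensions*, LNM 2216 (2018), Prop. 2.53, Thm. 2.49. [Wendl2018]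
-/

noncomputable section

open scoped Manifold ContDiff Topology
open CategoryTheory Set Function Metric Complex
open Literature.Topology.FourManifolds Literature.Topology.FourManifolds.ComplexProjectiveSpace
  Literature.AlgebraicTopology.SingularHomology Literature.Topology.PlaneTopology

namespace Literature.Geometry.Symplectic

open SphereZeroSetIndex

/-- **The intersection indices of smooth spheres with a CLOSED co-oriented surface `K = {π = 0}`
add up to a homological invariant — without compactness of the ambient manifold.** This is the
statement of the named fact `Literature.Geometry.Symplectic.sphere_zeroSetIndex_factorsThroughHomology`
(`SphereIntersectionIndexHomological.lean`; Bredon 1993, VI.11 Def. 11.1, Thm. 11.9 and p. 375;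
IV.7 Cor. 7.5) with its two inessential hypotheses removed: `X` need not be compact and `π`
need not be a submersion; the zero set `K = {y ∈ U | π y = 0}` is only assumed CLOSED in `X`
(for instance a compact leaf of a local foliation inside a NON-compact almost complex
4-manifold, the situation of `hls_localFoliation_embeddedSphere_trivialNormal`). The proof is,
verbatim, the homological argument of `sphere_zeroSetIndex_factorsThroughHomology_holds`
(`SphereIntersectionIndexHomologicalProofs.lean`, which uses compactness of `K` only through
its closedness): the functional is `± (H₂(X) → H₂(X | K) ≅ H₂(U | K) → H₂(ℂ | 0) ≅ ℤ)` and its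
value on a glued sphere is the sum over the crossings of the local degrees = winding numbers.
[cite: Bredon1993, VI.11 Thm. 11.9 and p. 375; IV.7 Cor. 7.5] -/
theorem sphere_zeroSetIndex_factorsThroughHomology_of_isClosed
    (X : Type) [TopologicalSpace X] [T2Space X] [SecondCountableTopology X]
    [ChartedSpace (EuclideanSpace ℝ (Fin 4)) X] [IsManifold (𝓡 4) ∞ X]
    (π : X → ℂ) (U : Set X) (hU : IsOpen U) (hπ : ContMDiffOn (𝓡 4) 𝓘(ℝ, ℂ) ∞ π U)
    (hPc' : IsClosed {y : X | y ∈ U ∧ π y = 0}) :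
    ∃ c : singularHomology ℤ ℤ X (2 * 1) →+ ℤ,
      ∀ (u v : ℂ → X) (F : C(ComplexProjectiveSpace 1, X)),
        ContMDiff 𝓘(ℝ, ℂ) (𝓡 4) ∞ u → ContMDiff 𝓘(ℝ, ℂ) (𝓡 4) ∞ v → (∀ z : ℂ, z ≠ 0 → v z = u z⁻¹) →
        (∀ p, CoordNeZero 0 p → F p = u (affineCoordComplex 0 p 0)) →
        (∀ p, CoordNeZero 1 p → F p = v (affineCoordComplex 1 p 0)) →
        {z : ℂ | u z ∈ U ∧ π (u z) = 0}.Finite →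
        ∃ r₀ : ℝ, 0 < r₀ ∧ ∀ r : ℝ, 0 < r → r ≤ r₀ →
          c (singularHomology.map ℤ ℤ F (2 * 1)
              (ComplexProjectiveSpace.homologicalOrientationInt 1).fundamentalClass) =
            (∑ᶠ z ∈ {z : ℂ | u z ∈ U ∧ π (u z) = 0}, wind (fun t => π (u (circleLoop z r t)))) +
            (∑ᶠ w ∈ {w : ℂ | w = 0 ∧ v w ∈ U ∧ π (v w) = 0}, wind (fun t => π (v (circleLoop w r t)))) := by
  classical
  -- the zero set `P`, the normal coordinate `K♯ = π|U`
  set P : Set X := {y : X | y ∈ U ∧ π y = 0} with hPdef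
  have hPc : IsClosed P := hPc'
  have hPU : P ⊆ U := fun y hy => hy.1
  have hπc : ContinuousOn π U := hπ.continuousOn
  let Kn : C(↥U, ℂ) := ⟨fun y => π y, hπc.restrict⟩
  have hK : MapsTo Kn (Subtype.val ⁻¹' Pᶜ) ({0}ᶜ : Set ℂ) := fun y hy h0 => hy ⟨y.2, h0⟩
  -- orientations: `g` of the model plane, `μ₀` of `ℂℙ¹` (positive atlas), the generator `b₀`
  obtain ⟨g₂⟩ := nonempty_homologicalOrientation_euclidean 2
  let g : HomologicalOrientation ℤ (EuclideanSpace ℝ (Fin (2 * 1))) (2 * 1) := g₂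
  have hXpos : IsPositiveAtlas (2 * 1) (ComplexProjectiveSpace 1) := ComplexProjectiveSpace.isPositiveAtlas 1
  -- the identification `ι : ℂ ≃ ℝ²` of the affine charts
  set ι : ℂ ≃L[ℝ] (EuclideanSpace ℝ (Fin (2 * 1))) :=
    (ContinuousLinearEquiv.funUnique (Fin 1) ℝ ℂ).symm.trans (realCoordinates 1) with hιdef
  have hι : ∀ (i : Fin (1 + 1)) (p : ComplexProjectiveSpace 1), affineChart i p = ι (affineCoordComplex i p 0) :=
    affineChart_eq_iota
  let μ₀ : HomologicalOrientation ℤ (ComplexProjectiveSpace 1) (2 * 1) := positiveAtlasOrientation hXpos g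
  let b₀ : relativeSingularHomology ℤ ℤ ℂ ({0}ᶜ : Set ℂ) (2 * 1) :=
    relativeSingularHomology.xEquiv ℤ ℤ ι.symm.toHomeomorph (mapsTo_iota_symm ι)
      (mapsTo_iota_symm_symm ι) (2 * 1) (g.localClass (ι 0))
  obtain ⟨eg, heg⟩ := g.isGenerator (ι 0)
  let eb : relativeSingularHomology ℤ ℤ ℂ ({0}ᶜ : Set ℂ) (2 * 1) ≃ₗ[ℤ] ℤ :=
    (relativeSingularHomology.xEquiv ℤ ℤ ι.symm.toHomeomorph (mapsTo_iota_symm ι)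
      (mapsTo_iota_symm_symm ι) (2 * 1)).symm.trans eg
  have heb : eb b₀ = 1 := by
    simp only [eb, b₀, LinearEquiv.trans_apply, LinearEquiv.symm_apply_apply]
    exact heg
  -- the functional `Λ : H₂(X) → H₂(X | P) ≅ H₂(U | P) → H₂(ℂ | 0)` and `cΛ = eb ∘ Λ`
  haveI := isIso_map_subsetIncl_of_isClosed_subset hPc hU hPU (2 * 1)
  let exc := relativeSingularHomology.map ℤ ℤ (subsetIncl U) (mapsTo_preimage Subtype.val Pᶜ) (2 * 1)
  let Λ : singularHomology ℤ ℤ X (2 * 1) ⟶ relativeSingularHomology ℤ ℤ ℂ ({0}ᶜ : Set ℂ) (2 * 1) :=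
    singularHomology.toLocalOfSet ℤ ℤ X P (2 * 1) ≫ inv exc ≫ relativeSingularHomology.map ℤ ℤ Kn hK (2 * 1)
  let cΛ : singularHomology ℤ ℤ X (2 * 1) →+ ℤ := eb.toAddMonoidHom.comp Λ.hom.toAddMonoidHom
  have hcΛ : ∀ x, cΛ x = eb (relativeSingularHomology.map ℤ ℤ Kn hK (2 * 1)
      (inv exc (singularHomology.toLocalOfSet ℤ ℤ X P (2 * 1) x))) := fun x => rfl
  -- CORE: the value on a glued sphere, for the positive-atlas orientation `μ₀`
  have core : ∀ (u v : ℂ → X) (F : C(ComplexProjectiveSpace 1, X)),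
      ContMDiff 𝓘(ℝ, ℂ) (𝓡 4) ∞ u → ContMDiff 𝓘(ℝ, ℂ) (𝓡 4) ∞ v → (∀ z : ℂ, z ≠ 0 → v z = u z⁻¹) →
      (∀ p, CoordNeZero 0 p → F p = u (affineCoordComplex 0 p 0)) →
      (∀ p, CoordNeZero 1 p → F p = v (affineCoordComplex 1 p 0)) →
      {z : ℂ | u z ∈ U ∧ π (u z) = 0}.Finite →
      ∃ r₀ : ℝ, 0 < r₀ ∧ ∀ r : ℝ, 0 < r → r ≤ r₀ →
        cΛ (singularHomology.map ℤ ℤ F (2 * 1) μ₀.fundamentalClass) =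
          (∑ᶠ z ∈ {z : ℂ | u z ∈ U ∧ π (u z) = 0}, wind (fun t => π (u (circleLoop z r t)))) +
          (∑ᶠ w ∈ {w : ℂ | w = 0 ∧ v w ∈ U ∧ π (v w) = 0}, wind (fun t => π (v (circleLoop w r t)))) := by
    intro u v F hu hv huv hF0 hF1 hfin
    have huc : Continuous u := hu.continuous
    have hvc : Continuous v := hv.continuous
    set Z : Set ℂ := {z : ℂ | u z ∈ U ∧ π (u z) = 0} with hZ
    set Zi : Set ℂ := {w : ℂ | w = 0 ∧ v w ∈ U ∧ π (v w) = 0} with hZi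
    have hZi_fin : Zi.Finite := (Set.finite_singleton (0 : ℂ)).subset fun w hw => hw.1
    haveI : Fintype ↥Z := hfin.fintype
    haveI : Fintype ↥Zi := hZi_fin.fintype
    -- radii for the chart-`0` crossings
    have hZopen : IsOpen (u ⁻¹' U) := hU.preimage huc
    have hδ : ∀ z : ↥Z, ∃ δ > 0, ball (z : ℂ) δ ⊆ u ⁻¹' U ∧ ∀ z' ∈ Z, z' ∈ ball (z : ℂ) δ → z' = z := by
      intro z
      obtain ⟨δ₁, hδ₁, hb₁⟩ := Metric.isOpen_iff.1 hZopen z z.2.1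
      have hopen : IsOpen (Z \ {(z : ℂ)})ᶜ := (hfin.subset Set.sdiff_subset).isClosed.isOpen_compl
      obtain ⟨δ₂, hδ₂, hb₂⟩ := Metric.isOpen_iff.1 hopen z fun h => h.2 rfl
      refine ⟨min δ₁ δ₂, lt_min hδ₁ hδ₂, (ball_subset_ball (min_le_left _ _)).trans hb₁,
        fun z' hz' hb => ?_⟩
      by_contra hne
      exact hb₂ (ball_subset_ball (min_le_right _ _) hb) ⟨hz', hne⟩
    choose δ hδpos hδU hδsep using hδ
    -- radius for the chart-`1` crossing
    have hδi : ∃ δ' > 0, (v 0 ∈ U → ball (0 : ℂ) δ' ⊆ v ⁻¹' U) ∧ ∀ z ∈ Z, δ' * ‖z‖ < 1 := by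
      obtain ⟨δa, hδa, hba⟩ : ∃ δa > 0, v 0 ∈ U → ball (0 : ℂ) δa ⊆ v ⁻¹' U := by
        by_cases h0 : v 0 ∈ U
        · obtain ⟨δa, hδa, hba⟩ := Metric.isOpen_iff.1 (hU.preimage hvc) 0 h0
          exact ⟨δa, hδa, fun _ => hba⟩
        · exact ⟨1, one_pos, fun h => absurd h h0⟩
      set M : ℝ := ∑ z ∈ hfin.toFinset, ‖z‖ with hM
      have hMz : ∀ z ∈ Z, ‖z‖ ≤ M := fun z hz =>
        Finset.single_le_sum (f := fun z : ℂ => ‖z‖) (fun _ _ => norm_nonneg _) (hfin.mem_toFinset.2 hz)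
      have hM0 : 0 ≤ M := Finset.sum_nonneg fun _ _ => norm_nonneg _
      refine ⟨min δa (1 / (1 + M)), lt_min hδa (by positivity), fun h0 =>
        (ball_subset_ball (min_le_left _ _)).trans (hba h0), fun z hz => ?_⟩
      calc min δa (1 / (1 + M)) * ‖z‖ ≤ 1 / (1 + M) * M :=
            mul_le_mul (min_le_right _ _) (hMz z hz) (norm_nonneg _) (by positivity)
        _ < 1 := by rw [div_mul_eq_mul_div, one_mul, div_lt_one (by positivity)]; linarith
    obtain ⟨δ', hδ'pos, hδ'U, hδ'Z⟩ := hδi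
    -- the crossing data, indexed by `ι = Z ⊕ Zi`
    let ci : ↥Z ⊕ ↥Zi → Fin (1 + 1) := Sum.elim (fun _ => 0) (fun _ => 1)
    let zc : ↥Z ⊕ ↥Zi → ℂ := Sum.elim (fun z => (z : ℂ)) (fun w => (w : ℂ))
    let δc : ↥Z ⊕ ↥Zi → ℝ := Sum.elim (fun z => δ z) (fun _ => δ')
    have hδc : ∀ i, 0 < δc i := by
      rintro (z | w)
      · exact hδpos z
      · exact hδ'pos
    let Wset : ↥Z ⊕ ↥Zi → Set (ComplexProjectiveSpace 1) := fun i =>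
      (affineChart (ci i)).source ∩
        affineChart (ci i) ⁻¹' (ι.symm ⁻¹' ball (zc i) (δc i))
    have hWo : ∀ i, IsOpen (Wset i) := fun i =>
      (affineChart (ci i)).isOpen_inter_preimage (isOpen_ball.preimage ι.symm.continuous)
    have hWmem : ∀ i p, p ∈ Wset i ↔ CoordNeZero (ci i) p ∧ affineCoordComplex (ci i) p 0 ∈ ball (zc i) (δc i) := by
      intro i p
      simp only [Wset, mem_inter_iff, mem_preimage, affineChart_source, mem_setOf_eq, hι,
        ContinuousLinearEquiv.symm_apply_apply]
    let c' : ∀ i, OpenPartialHomeomorph (ComplexProjectiveSpace 1) (EuclideanSpace ℝ (Fin (2 * 1))) := fun i =>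
      (affineChart (ci i)).restrOpen (Wset i) (hWo i)
    let Uset : ↥Z ⊕ ↥Zi → Set (ComplexProjectiveSpace 1) := fun i => (c' i).source
    have hUmem : ∀ i p, p ∈ Uset i ↔ CoordNeZero (ci i) p ∧ affineCoordComplex (ci i) p 0 ∈ ball (zc i) (δc i) := by
      intro i p
      rw [← hWmem]
      change p ∈ (affineChart (ci i)).source ∩ Wset i ↔ _
      exact ⟨fun h => h.2, fun h => ⟨((hWmem i p).1 h).1, h⟩⟩
    have hrpt : ∀ i, ι (zc i) ∈ (c' i).target := by
      intro i
      refine ⟨mem_univ _, ?_⟩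
      change (affineChart (ci i)).symm (ι (zc i)) ∈ Wset i
      rw [hWmem]
      refine ⟨coordNeZero_affineChart_symm _ _, ?_⟩
      rw [affineCoordComplex_symm_iota ι hι]
      exact mem_ball_self (hδc i)
    let rpt : ∀ i, ↥(c' i).target := fun i => ⟨ι (zc i), hrpt i⟩
    let vpt : ↥Z ⊕ ↥Zi → ComplexProjectiveSpace 1 := fun i =>
      ((c' i).toHomeomorphSourceTarget.symm (rpt i) : ComplexProjectiveSpace 1)
    have hvU : ∀ i, vpt i ∈ Uset i := fun i => ((c' i).toHomeomorphSourceTarget.symm (rpt i)).2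
    have hvpt : ∀ i, vpt i = (affineChart (ci i)).symm (ι (zc i)) := fun i => rfl
    have hvcoord : ∀ i, CoordNeZero (ci i) (vpt i) ∧ affineCoordComplex (ci i) (vpt i) 0 = zc i := fun i =>
      ⟨coordNeZero_affineChart_symm _ _, affineCoordComplex_symm_iota ι hι _ _⟩
    -- values of `F` on the chart domains
    have hFU : ∀ i, ∀ t ∈ Uset i, F t = Sum.elim (fun _ => u (affineCoordComplex 0 t 0))
        (fun _ => v (affineCoordComplex 1 t 0)) i := by
      rintro (z | w) t ht
      · exact hF0 t ((hUmem _ t).1 ht).1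
      · exact hF1 t ((hUmem _ t).1 ht).1
    have hZi0 : ∀ w : ↥Zi, (w : ℂ) = 0 := fun w => w.2.1
    have hUN : ∀ i, ∀ t ∈ Uset i, F t ∈ U := by
      rintro (z | w) t ht
      · obtain ⟨h0, hb⟩ := (hUmem _ t).1 ht
        rw [hF0 t h0]
        exact hδU z hb
      · obtain ⟨h1, hb⟩ := (hUmem _ t).1 ht
        rw [hF1 t h1]
        have hv0 : v 0 ∈ U := by rw [← hZi0 w]; exact w.2.2.1
        have hb' : affineCoordComplex 1 t 0 ∈ ball (0 : ℂ) δ' := by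
          have := hb; rwa [show zc (Sum.inr w) = (w : ℂ) from rfl, hZi0 w] at this
        exact hδ'U hv0 hb'
    -- separation of the crossings
    have hinfty : ∀ w : ↥Zi, vpt (Sum.inr w) = (affineChart 1).symm (ι 0) := by
      intro w
      rw [hvpt, show zc (Sum.inr w) = (w : ℂ) from rfl, hZi0 w]
      rfl
    have hsep : ∀ i l, l ≠ i → vpt l ∉ Uset i := by
      rintro (z | w) (z' | w') hne hmem
      · -- two chart-`0` crossings
        obtain ⟨-, hb⟩ := (hUmem _ _).1 hmem
        have hc0 : affineCoordComplex 0 (vpt (Sum.inl z')) 0 = z' := (hvcoord (Sum.inl z')).2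
        have hb' : affineCoordComplex 0 (vpt (Sum.inl z')) 0 ∈ ball (z : ℂ) (δ z) := hb
        rw [hc0] at hb'
        exact hne (congrArg Sum.inl (Subtype.ext (hδsep z z' z'.2 hb')))
      · -- `∞` is not in the chart-`0` domain
        obtain ⟨h0, -⟩ := (hUmem _ _).1 hmem
        rw [hinfty] at h0
        exact not_coordNeZero_zero_infty ι hι h0
      · -- a chart-`0` crossing in the chart-`1` neighbourhood of `∞`: `‖1/z‖ < δ'`
        obtain ⟨h1, hb⟩ := (hUmem _ _).1 hmem
        have h0 : CoordNeZero 0 (vpt (Sum.inl z')) := (hvcoord (Sum.inl z')).1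
        have hinv := affineCoordComplex_one_eq_inv (vpt (Sum.inl z'))
        have hz0 := affineCoordComplex_zero_ne_zero h0 h1
        have hc0 : affineCoordComplex 0 (vpt (Sum.inl z')) 0 = z' := (hvcoord (Sum.inl z')).2
        have hb' : affineCoordComplex 1 (vpt (Sum.inl z')) 0 ∈ ball (w : ℂ) δ' := hb
        rw [hinv, hc0, hZi0 w, mem_ball_zero_iff, norm_inv] at hb'
        clear hb
        have hb := hb'
        have hlt := hδ'Z z' z'.2
        rw [hc0] at hz0
        have hzpos : 0 < ‖(z' : ℂ)‖ := norm_pos_iff.2 hz0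
        rw [inv_lt_iff_one_lt_mul₀ hzpos] at hb
        linarith [mul_comm δ' ‖(z' : ℂ)‖]
      · -- two chart-`1` crossings coincide
        exact hne (congrArg Sum.inr (Subtype.ext ((hZi0 w').trans (hZi0 w).symm)))
    have hvinj : Injective vpt := by
      intro i l h
      by_contra hne
      exact hsep i l (Ne.symm hne) (h ▸ hvU i)
    -- the crossing set
    have hF : {t | F t ∈ P} = ⋃ i ∈ (Finset.univ : Finset (↥Z ⊕ ↥Zi)), ({vpt i} : Set (ComplexProjectiveSpace 1)) := by
      ext t
      simp only [mem_setOf_eq, mem_iUnion, mem_singleton_iff, Finset.mem_univ, exists_true_left]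
      constructor
      · intro ht
        rcases coordNeZero_zero_or_eq_infty ι hι t with h0 | hinf
        · have hFt : F t = u (affineCoordComplex 0 t 0) := hF0 t h0
          have hzZ : affineCoordComplex 0 t 0 ∈ Z := by
            have := ht; rw [hFt] at this; exact this
          refine ⟨Sum.inl ⟨_, hzZ⟩, ?_⟩
          rw [hvpt]
          exact eq_symm_iota_of_coordNeZero ι hι h0
        · have h1 : CoordNeZero 1 t := by rw [hinf]; exact coordNeZero_affineChart_symm 1 _
          have hFt : F t = v 0 := by
            rw [hF1 t h1, hinf, affineCoordComplex_symm_iota ι hι]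
          have h0Z : (0 : ℂ) ∈ Zi := ⟨rfl, by have := ht; rw [hFt] at this; exact this⟩
          refine ⟨Sum.inr ⟨0, h0Z⟩, ?_⟩
          rw [hinfty, hinf]
      · rintro ⟨i, rfl⟩
        rcases i with z | w
        · show F (vpt (Sum.inl z)) ∈ P
          have hc0 : affineCoordComplex 0 (vpt (Sum.inl z)) 0 = z := (hvcoord (Sum.inl z)).2
          rw [hF0 _ (hvcoord (Sum.inl z)).1, hc0]
          exact z.2
        · show F (vpt (Sum.inr w)) ∈ P
          have hc1 : affineCoordComplex 1 (vpt (Sum.inr w)) 0 = w := (hvcoord (Sum.inr w)).2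
          rw [hF1 _ (hvcoord (Sum.inr w)).1, hc1]
          exact w.2.2
    -- the local pieces of `[ℂℙ¹]_{μ₀}` at the crossings and their local values
    let wpc : ∀ i, relativeSingularHomology ℤ ℤ ↥(Uset i) ({(⟨vpt i, hvU i⟩ : ↥(Uset i))}ᶜ) (2 * 1) := fun i =>
      localHomology.xEquiv ℤ ℤ (c' i).toHomeomorphSourceTarget.symm (rpt i) (2 * 1)
        ((localHomology.openSubsetIso ℤ ℤ (c' i).open_target (rpt i).2 (2 * 1)).inv (g.localClass (rpt i : (EuclideanSpace ℝ (Fin (2 * 1))))))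
    have hatlas : ∀ i, affineChart (ci i) ∈ atlas (EuclideanSpace ℝ (Fin (2 * 1))) (ComplexProjectiveSpace 1) := fun i =>
      (mem_atlas_iff _).2 ⟨ci i, rfl⟩
    have hσ : ∀ i, relativeSingularHomology.map ℤ ℤ (subsetIncl (Uset i))
        (localHomology.mapsTo_subsetIncl_compl (hvU i)) (2 * 1) (wpc i) =
        singularHomology.toLocal ℤ ℤ (vpt i) (2 * 1) μ₀.fundamentalClass := by
      intro i
      rw [HomologicalOrientation.isFundamentalClass_fundamentalClass_holds (2 * 1) μ₀ (vpt i)]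
      exact positiveAtlasOrientation_localClass_symm_restrOpen hXpos g (hatlas i) (hWo i) (rpt i)
    have hKφ : ∀ i, MapsTo (fun t : ↥(Uset i) => Kn ⟨F t, hUN i t t.2⟩)
        ({(⟨vpt i, hvU i⟩ : ↥(Uset i))}ᶜ : Set ↥(Uset i)) ({0}ᶜ : Set ℂ) := fun i =>
      hK.comp (mapsTo_crossingNhd F hUN hvU hsep hF i)
    -- a common small radius
    obtain ⟨r₀, hr₀, hr₀lt⟩ := exists_pos_lt_forall δc hδc
    refine ⟨r₀, hr₀, fun r hr hrr₀ => ?_⟩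
    have hρW : ∀ i, ι '' closedBall (ι.symm (rpt i)) r ⊆ (c' i).target := by
      intro i
      rintro _ ⟨ζ, hζ, rfl⟩
      refine ⟨mem_univ _, ?_⟩
      change (affineChart (ci i)).symm (ι ζ) ∈ Wset i
      rw [hWmem]
      refine ⟨coordNeZero_affineChart_symm _ _, ?_⟩
      rw [affineCoordComplex_symm_iota ι hι, mem_ball_iff_norm]
      have hζ' : ‖ζ - zc i‖ ≤ r := by
        have := mem_closedBall_iff_norm.1 hζ
        rwa [show (ι.symm (rpt i) : ℂ) = zc i from
          ι.symm_apply_apply (zc i)] at this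
      exact hζ'.trans_lt (hrr₀.trans_lt (hr₀lt i))
    let d : ↥Z ⊕ ↥Zi → ℤ := fun i =>
      wind (fun s => π (F ((affineChart (ci i)).symm (ι
        (circleLoop (ι.symm (rpt i)) r s)))))
    have hw : ∀ i, relativeSingularHomology.map ℤ ℤ
        (⟨fun t : ↥(Uset i) => Kn ⟨F t, hUN i t t.2⟩, by fun_prop⟩ : C(↥(Uset i), ℂ)) (hKφ i) (2 * 1)
        (wpc i) = d i • b₀ := fun i =>
      map_chartClass_eq_wind_smul g ι π hπc F (affineChart (ci i)) (hWo i) (hUN i) (rpt i) (hKφ i) hr (hρW i)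
    -- the sum formula
    have hz : exc (inv exc (singularHomology.toLocalOfSet ℤ ℤ X P (2 * 1)
        (singularHomology.map ℤ ℤ F (2 * 1) μ₀.fundamentalClass))) =
        singularHomology.toLocalOfSet ℤ ℤ X P (2 * 1) (singularHomology.map ℤ ℤ F (2 * 1) μ₀.fundamentalClass) := by
      rw [← ModuleCat.comp_apply, IsIso.inv_hom_id, ModuleCat.id_apply]
    have hB := map_eq_sum_smul_of_crossings hPc hU hPU Kn hK (2 * 1) F hUN hvinj hvU hsep hF
      μ₀.fundamentalClass wpc hσ hKφ b₀ d hw _ hz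
    have hsum1 : (∑ z : ↥Z, d (Sum.inl z)) = ∑ᶠ z ∈ Z, wind (fun t => π (u (circleLoop z r t))) := by
      rw [← finsum_set_coe_eq_finsum_mem, finsum_eq_sum_of_fintype]
      refine Finset.sum_congr rfl fun z _ => ?_
      change wind _ = wind _
      congr 1
      funext s
      show π (F ((affineChart 0).symm (ι
        (circleLoop (ι.symm (ι (z : ℂ))) r s)))) = π (u (circleLoop z r s))
      rw [ι.symm_apply_apply, hF0 _ (coordNeZero_affineChart_symm 0 _), affineCoordComplex_symm_iota ι hι]
    have hsum2 : (∑ w : ↥Zi, d (Sum.inr w)) = ∑ᶠ w ∈ Zi, wind (fun t => π (v (circleLoop w r t))) := by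
      rw [← finsum_set_coe_eq_finsum_mem, finsum_eq_sum_of_fintype]
      refine Finset.sum_congr rfl fun w _ => ?_
      change wind _ = wind _
      congr 1
      funext s
      show π (F ((affineChart 1).symm (ι
        (circleLoop (ι.symm (ι (w : ℂ))) r s)))) = π (v (circleLoop w r s))
      rw [ι.symm_apply_apply, hF1 _ (coordNeZero_affineChart_symm 1 _), affineCoordComplex_symm_iota ι hι]
    rw [hcΛ, hB, map_zsmul, heb, zsmul_eq_mul, mul_one, Fintype.sum_sum_type, hsum1, hsum2, Int.cast_id]
  -- the sign: `homologicalOrientationInt 1 = ± μ₀`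
  rcases HomologicalOrientation.eq_or_eq_neg_of_connected_holds (ComplexProjectiveSpace 1)
    (ComplexProjectiveSpace.homologicalOrientationInt 1) μ₀ with hμ | hμ
  · refine ⟨cΛ, fun u v F hu hv huv hF0 hF1 hfin => ?_⟩
    obtain ⟨r₀, hr₀, H⟩ := core u v F hu hv huv hF0 hF1 hfin
    refine ⟨r₀, hr₀, fun r hr hrr₀ => ?_⟩
    rw [hμ]
    exact H r hr hrr₀
  · refine ⟨-cΛ, fun u v F hu hv huv hF0 hF1 hfin => ?_⟩
    obtain ⟨r₀, hr₀, H⟩ := core u v F hu hv huv hF0 hF1 hfin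
    refine ⟨r₀, hr₀, fun r hr hrr₀ => ?_⟩
    rw [hμ, HomologicalOrientation.fundamentalClass_neg_holds ℤ (ComplexProjectiveSpace 1) (2 * 1) μ₀, map_neg,
      AddMonoidHom.neg_apply, map_neg, neg_neg]
    exact H r hr hrr₀


end Literature.Geometry.Symplectic

end
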